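import Literature.MathematicalPhysics.QuantumFieldTheory.Balaban1983to89.B12BetaAsPrinted
import Summits.QuantumFields.BalabanUV.Beta.EriceFlowEnclosureB12AsPrintedMarginal

/-!
# Beta / EriceFlowEnclosureB12AsPrintedOrientation — the symmetry clauses (5.6)–(5.8) of `B12BetaAsPrinted.Definitions.d121`
# against the remainder Π′ = Π − β·`wilsonQ μ ν` of `Conclusions.c537`: which printed symmetries the typed Π′ keeps, which one it
# cannot keep, and the transposed reading that repairs it (β-flow team, prover 1, unit `b2b-balaban-beta-bflow-p1`, gen 32; ROW AP-I
# = [I] AS PRINTED; PART 2 of the orientation audit — PART 1 = `…B12AsPrintedMarginal` (the kernel facts), witnesses =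
# `…B12AsPrintedWitness`)

HONEST FRAMING (page 1 of everything the β sub-cell writes): discharging `BetaPertH` makes Bałaban's UV stability UNCONDITIONAL — a
real constructive-QFT result; it is NOT the continuum limit and NOT the Clay problem.  HONEST DEPENDENCY (cell reorg 2026-08-19,
verbatim): «continuum YM on T⁴ ⇐ BetaPertH ∧ nine spine estimates (0/9 proved); BetaPertH ⇐ (D1) ∧ (D4) ∧ CAP+tail; G-an2-4 gates
asym, D1 and NE2/3/4.»  THIS MODULE DISCHARGES NOTHING: it is bookkeeping over the NAMED FIELDS of the statement-exact typing of
[I] = T. Bałaban, Commun. Math. Phys. **109** (1987) 249–301 [Balaban1987RG1] — `B12BetaAsPrinted` (typer unit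
`b2b-balaban-beta-asprinted`; p537882 ✓ ∕ v1.1 p539116 ✓): `Definitions S` (the printed definitions, a HYPOTHESIS on an abstract
`Setting S`) and `Conclusions S` (Theorem 3's printed conclusions, a HYPOTHESIS) — composed BY NAME with PART 1's [folklore] facts
about the explicit kernel `B12Rep537.wilsonQ`.  Nothing of [I] is asserted; no field of the interface is claimed to hold for any
setting built from Bałaban's objects.

THE POINT (reported to the typer ∕ row-D4 owner ∕ fit-referees, journal [BFLOW-P1-G32-XREAD-I-1]).  `Definitions.d121` types (1.21)₂ in
the ℤ⁴ form (5.6)–(5.8) p. 293 for the kernels Π_{j+1}(g₀, …, g_j; ·) = `S.polIV j p`: permutations, the REFLECTIONS (5.7) read for the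
difference variable — `Π_{μν}(κ ↦ ε_κ z_κ − [κ = μ](1 − ε_μ)∕2 + [κ = ν](1 − ε_ν)∕2) = ε_μ ε_ν Π_{μν}(z)` — and the transposition law
(5.8) `Π_{μν}(z) = Π_{νμ}(−z)`.  `Conclusions.c537` types (5.37)∕(5.38): along every run Theorem 3 speaks of,
`Π_{j+1,μν}(…, s; x) − β_{j+1}(…, s)·wilsonQ μ ν x = Σ_w D_w Π′_w(x)` with decaying Π′_w; its docstring quotes p. 297 *"The function
Π′_{μν}(p) has all the symmetries of the function Π_{μν}(p)"* (NOT a typed conjunct).  PART 1 proved: `wilsonQ μ ν` keeps (5.6), (5.8)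
and BREAKS the typed (5.7) for μ ≠ ν, while `wilsonQ ν μ` keeps all three.  HERE: for every `S` with `Definitions S`, the typed
Π′_{μν} := Π_{j+1,μν} − β_{j+1}·`wilsonQ μ ν` keeps (5.6) and (5.8) (`remainder537_perm`, `remainder537_transpose`) and, wherever
β_{j+1} ≠ 0 and μ ≠ ν, VIOLATES the typed (5.7) (`remainder537_not_reflect`; along runs with `c537`'s own Π′:
`c537_remainder_not_reflect_of_conclusions`) — so AS TYPED the pair (`d121` reflections, `c537`) is oriented OPPOSITELY to p. 297's
sentence; with the TRANSPOSED marginal kernel `wilsonQ ν μ` (equivalently: the two half-shifts of `d121` exchanged) all three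
symmetries of Π − β·Q hold (`transposedRemainder537_reflect` ∕ `_perm` ∕ `_transpose`).  Which of the two typed clauses is
«transposed relative to print» is a Fourier-sign ∕ difference-variable convention ([I] (5.15) ∂_μ(p) = e^{ip_μ} − 1, (5.8)
Π(x, y) = Π(x − y); `PeriodicGleason.genFun` in powers zⁿ) that the kernel cannot decide; this module records the kernel-decidable
half.  THE PAGE READ OF RECORD (row-D4 OWNER `b2b-balaban-beta-an4` gen 141, journal [AN4-G141-WORD-I-1], reproduced the violation
count independently and decided it from [I]'s own bond convention (5.4), the two-point (5.7), (5.11) Π̃(p) = Σ e^{−ipx}Π(x) and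
(5.15) ∂_μ(ζ) = e^{iζ_μ} − 1): `d121` AS TYPED is the right law (the Hessian of the linearised Wilson action satisfies the
two-point (5.7) exactly and has difference kernel `wilsonQ ν μ`), while `c537`'s `wilsonQ μ ν` IS the literal (5.37) — so the
transposition sits INSIDE print: (5.37) as printed is the νμ-transpose of what (5.4)∕(5.7)∕(5.11)∕(5.15) force, a β-BLIND slip
(order ≤ 2 data are symmetric under the transpose: (1.22)∕(5.42), `d122`, the row-D4 chain untouched); only Π′ absorbs the two
third-order words.  The typed predicate is CONSISTENT as it stands (PART 1 `crossQ_sub_transpose`; the witness module's AF toy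
satisfies StandingHypotheses ∧ Definitions ∧ Conclusions ∧ Theorem2Statement with β ≠ 0).

WHAT THIS FILE PROVES (0 sorry, 0 def; d = 4; `S : Setting` arbitrary, `Definitions S` ∕ `Conclusions S` ∕ `RunHyp S P` as hypotheses):
`polIV_reflect` (`d121`'s reflection clause on the complex carrier); `remainder537_perm` ((5.6) ✓ for Π − β·wilsonQ μ ν);
`remainder537_transpose` ((5.8) ✓); **`remainder537_not_reflect`** (typed (5.7) ✗ wherever β_{j+1} ≠ 0, μ ≠ ν);
`c537_remainder_not_reflect` (the same for ANY third-order representation Σ_w D_w Π′_w of Π − β·wilsonQ μ ν along a run section),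
**`c537_remainder_not_reflect_of_conclusions`** (with `Conclusions.c537`'s own Π′: along every `RunHyp` run, j + 1 ≤ K, s ∈ [0, γ],
β_{j+1}(g₀, …, g_{j−1}, s) ≠ 0, μ ≠ ν); **`transposedRemainder537_reflect`** ∕ `transposedRemainder537_perm` ∕
`transposedRemainder537_transpose` (Π − β·wilsonQ ν μ keeps all three typed symmetries: the repair certificate).
NOT CLAIMED: which convention print intends; that any field of `B12BetaAsPrinted` holds for Bałaban's objects; anything about (1.22)'s
values or signs; `BetaPertH`; continuum; Clay.
-/

namespace Summit.QuantumFields.BalabanUV.Beta.EriceFlowEnclosureB12AsPrintedOrientation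

open Literature.MathematicalPhysics.QuantumFieldTheory.GawedzkiKupiainen1985.PeriodicGleason (Pt delta unitVec ExpBound)
open Literature.MathematicalPhysics.QuantumFieldTheory.Balaban1983to89
open Literature.MathematicalPhysics.QuantumFieldTheory.Balaban1983to89.B12Rep537 (wilsonQ crossQ dirac fdelta crossQ_apply)
open Literature.MathematicalPhysics.QuantumFieldTheory.Balaban1983to89.B12BetaAsPrinted
open Summit.QuantumFields.BalabanUV.Beta.EriceFlowEnclosureB12AsPrintedMarginal

noncomputable section

/-! ## §1 Consequences for the as-printed interface `B12BetaAsPrinted` (d = 4): which symmetries of Π the typed remainder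
Π′ = Π − β·`wilsonQ μ ν` of `Conclusions.c537` keeps, and which one it CANNOT keep -/

variable {S : Setting}

/-- The reflection clause of `Definitions.d121` for the run's kernel Π_{j+1}(g₀, …, g_j; ·), read on the complex carrier.
[cite: Balaban1987RG1, (5.7) p.293 with (1.21) p.264] -/
theorem polIV_reflect (hD : Definitions S) (j : ℕ) (p : Fin (j + 1) → ℝ) {ε : Fin 4 → ℤ}
    (hε : ∀ κ, ε κ = 1 ∨ ε κ = -1) (μ ν : Fin 4) (z : Pt 4) :
    ((S.polIV j p μ ν (fun κ => ε κ * z κ - (if κ = μ then (1 - ε μ) / 2 else 0) +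
        (if κ = ν then (1 - ε ν) / 2 else 0)) : ℝ) : ℂ) = ((ε μ * ε ν : ℤ) : ℂ) * (S.polIV j p μ ν z : ℂ) := by
  have h := (hD.d121 j p).2.1 ε hε μ ν z
  rw [h]
  push_cast
  ring

/-- **The typed remainder keeps the PERMUTATION symmetry (5.6).**  For every history, every permutation σ of the axes and
every x: `(Π_{σμ,σν} − β·Q_{σμ,σν})(x ∘ σ⁻¹) = (Π_{μν} − β·Q_{μν})(x)` with `Q = B12Rep537.wilsonQ` — from `d121`'s
`PermCovariant` clause and `wilsonQ_perm`. [cite: Balaban1987RG1, (5.6) p.293 with (5.37)–(5.38) p.297] -/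
theorem remainder537_perm (hD : Definitions S) (j : ℕ) (p : Fin (j + 1) → ℝ) (σ : Equiv.Perm (Fin 4))
    (μ ν : Fin 4) (x : Pt 4) :
    (S.polIV j p (σ μ) (σ ν) (x ∘ σ.symm) : ℂ) - (S.β j p : ℂ) * wilsonQ (σ μ) (σ ν) (x ∘ σ.symm) =
      (S.polIV j p μ ν x : ℂ) - (S.β j p : ℂ) * wilsonQ μ ν x := by
  rw [(hD.d121 j p).1 σ μ ν x, wilsonQ_perm]

/-- **The typed remainder keeps the TRANSPOSITION symmetry (5.8).**  `(Π_{μν} − β·Q_{μν})(z) = (Π_{νμ} − β·Q_{νμ})(−z)` — from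
`d121`'s third clause and `wilsonQ_neg_transpose`. [cite: Balaban1987RG1, (5.8) p.293 with (5.37)–(5.38) p.297] -/
theorem remainder537_transpose (hD : Definitions S) (j : ℕ) (p : Fin (j + 1) → ℝ) (μ ν : Fin 4) (z : Pt 4) :
    (S.polIV j p μ ν z : ℂ) - (S.β j p : ℂ) * wilsonQ μ ν z =
      (S.polIV j p ν μ (-z) : ℂ) - (S.β j p : ℂ) * wilsonQ ν μ (-z) := by
  rw [(hD.d121 j p).2.2 μ ν z, wilsonQ_neg_transpose]

/-- **THE TYPED REMAINDER CANNOT KEEP THE REFLECTION SYMMETRY (5.7).**  In every setting satisfying the printed `Definitions`,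
at every history where `β_{j+1} ≠ 0` and for every pair `μ ≠ ν`, the function Π′_{μν} := Π_{j+1,μν} − β_{j+1}·`wilsonQ μ ν` — the
left member of `Conclusions.c537`'s representation (5.37)∕(5.38) — VIOLATES the reflection clause of `Definitions.d121`: Π keeps it
(`d121`), `wilsonQ μ ν` breaks it (`wilsonQ_not_reflect`), and β ≠ 0.  Print (p. 297, quoted in `c537`'s docstring): *"The function
Π′_{μν}(p) has all the symmetries of the function Π_{μν}(p)"* — so, AS TYPED, the pair (`d121` reflection clause, `c537` with
`wilsonQ μ ν`) is ORIENTED OPPOSITELY to that sentence; the typed predicate itself stays consistent (the sentence is not a conjunct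
of `c537`; §4 and the witness module).  Either index order of the marginal kernel in `c537` (`wilsonQ ν μ`,
`transposedRemainder537_reflect`) or the opposite half-shifts in `d121` would restore it. [cite: Balaban1987RG1, (5.7) p.293 with (5.37)–(5.38) p.297] -/
theorem remainder537_not_reflect (hD : Definitions S) {j : ℕ} {p : Fin (j + 1) → ℝ} {μ ν : Fin 4} (hμν : μ ≠ ν)
    (hβ : S.β j p ≠ 0) :
    ¬ ∀ ε : Fin 4 → ℤ, (∀ κ, ε κ = 1 ∨ ε κ = -1) → ∀ z : Pt 4,
      (S.polIV j p μ ν (fun κ => ε κ * z κ - (if κ = μ then (1 - ε μ) / 2 else 0) +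
          (if κ = ν then (1 - ε ν) / 2 else 0)) : ℂ) -
        (S.β j p : ℂ) * wilsonQ μ ν (fun κ => ε κ * z κ - (if κ = μ then (1 - ε μ) / 2 else 0) +
          (if κ = ν then (1 - ε ν) / 2 else 0)) =
      ((ε μ * ε ν : ℤ) : ℂ) * ((S.polIV j p μ ν z : ℂ) - (S.β j p : ℂ) * wilsonQ μ ν z) := by
  intro h
  apply wilsonQ_not_reflect (d := 4) hμν
  intro ε hε z
  have h1 := h ε hε z
  have h2 := polIV_reflect hD j p hε μ ν z
  have hβ' : (S.β j p : ℂ) ≠ 0 := by exact_mod_cast hβ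
  have h3 : (S.β j p : ℂ) * wilsonQ μ ν (fun κ => ε κ * z κ - (if κ = μ then (1 - ε μ) / 2 else 0) +
      (if κ = ν then (1 - ε ν) / 2 else 0)) = (S.β j p : ℂ) * (((ε μ * ε ν : ℤ) : ℂ) * wilsonQ μ ν z) := by
    linear_combination h2 - h1
  exact mul_left_cancel₀ hβ' h3

/-- **The same, for the remainder kernels `c537` PRODUCES along a run.**  Whatever third-order representation
`Π_{j+1,μν}(…, s; x) − β_{j+1}(…, s)·Q_{μν}(x) = Σ_w D_w Π′_w(x)` holds (the shape of `Conclusions.c537`), the represented function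
`x ↦ Σ_w D_w Π′_w(x)` violates the reflection clause of `d121` as soon as `β_{j+1}(g₀, …, g_{j−1}, s) ≠ 0` and `μ ≠ ν`.
[cite: Balaban1987RG1, (5.7) p.293 with (5.37)–(5.38) p.297] -/
theorem c537_remainder_not_reflect (hD : Definitions S) {P : B12.RunParams} {j : ℕ} {s : ℝ} {μ ν : Fin 4}
    (hμν : μ ≠ ν) (hβ : lastSection S P j s ≠ 0) {rem : (Fin 3 → Fin 4 × Bool) → Pt 4 → ℂ}
    (hrep : ∀ x : Pt 4, (S.polIV j (sectionHist S P j s) μ ν x : ℂ) -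
        (S.β j (sectionHist S P j s) : ℂ) * B12Rep537.wilsonQ μ ν x = ∑ w, diffWord w (rem w) x) :
    ¬ ∀ ε : Fin 4 → ℤ, (∀ κ, ε κ = 1 ∨ ε κ = -1) → ∀ z : Pt 4,
      (∑ w, diffWord w (rem w) (fun κ => ε κ * z κ - (if κ = μ then (1 - ε μ) / 2 else 0) +
          (if κ = ν then (1 - ε ν) / 2 else 0))) = ((ε μ * ε ν : ℤ) : ℂ) * ∑ w, diffWord w (rem w) z := by
  intro h
  rw [lastSection_eq] at hβ
  apply remainder537_not_reflect hD hμν hβ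
  intro ε hε z
  rw [hrep, hrep]
  exact h ε hε z

/-- Along every run Theorem 3 speaks of, `Conclusions.c537` supplies such a representation at every step `j + 1 ≤ K`, every last
coupling `s ∈ [0, γ]` and every `(μ, ν)`; hence at every such place with `β_{j+1}(g₀, …, g_{j−1}, s) ≠ 0` and `μ ≠ ν` the remainder
print calls Π′_{μν} — AS TYPED — is NOT reflection-symmetric in the sense of `d121`. [cite: Balaban1987RG1, (5.37)–(5.38) p.297 with (5.7) p.293] -/
theorem c537_remainder_not_reflect_of_conclusions (hD : Definitions S) (hC : Conclusions S) {P : B12.RunParams}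
    (hP : RunHyp S P) {j : ℕ} (hj : j + 1 ≤ P.K) {s : ℝ} (hs : s ∈ Set.Icc (0 : ℝ) S.γ) {μ ν : Fin 4} (hμν : μ ≠ ν)
    (hβ : lastSection S P j s ≠ 0) :
    ∃ rem : (Fin 3 → Fin 4 × Bool) → Pt 4 → ℂ,
      (∀ x : Pt 4, (S.polIV j (sectionHist S P j s) μ ν x : ℂ) -
          (S.β j (sectionHist S P j s) : ℂ) * B12Rep537.wilsonQ μ ν x = ∑ w, diffWord w (rem w) x) ∧
      (∀ w, ExpBound (S.δ₁ / 2) (S.C544 * S.E₀) (rem w)) ∧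
      ¬ ∀ ε : Fin 4 → ℤ, (∀ κ, ε κ = 1 ∨ ε κ = -1) → ∀ z : Pt 4,
        (∑ w, diffWord w (rem w) (fun κ => ε κ * z κ - (if κ = μ then (1 - ε μ) / 2 else 0) +
            (if κ = ν then (1 - ε ν) / 2 else 0))) = ((ε μ * ε ν : ℤ) : ℂ) * ∑ w, diffWord w (rem w) z := by
  obtain ⟨rem, hrep, hdec⟩ := hC.c537 P hP j hj s hs μ ν
  exact ⟨rem, hrep, hdec, c537_remainder_not_reflect hD hμν hβ hrep⟩

/-- **REPAIR CERTIFICATE: with the transposed marginal kernel the obstruction disappears.**  For every setting with `Definitions S`,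
every history and every `(μ, ν)`: `x ↦ Π_{j+1,μν}(x) − β_{j+1}·Q_{νμ}(x)` (`wilsonQ ν μ`) DOES satisfy the reflection clause of `d121`
(and the permutation and transposition clauses, by `wilsonQ_perm` ∕ `wilsonQ_neg_transpose` as before).  So the sentence «Π′ has all
the symmetries of Π» is compatible with the typed `d121` once the marginal kernel of `c537` is read as `wilsonQ ν μ` — equivalently,
once the two half-shifts of `d121` are exchanged. [cite: Balaban1987RG1, (5.7) p.293 with (5.37)–(5.38) p.297] -/
theorem transposedRemainder537_reflect (hD : Definitions S) (j : ℕ) (p : Fin (j + 1) → ℝ) (μ ν : Fin 4)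
    {ε : Fin 4 → ℤ} (hε : ∀ κ, ε κ = 1 ∨ ε κ = -1) (z : Pt 4) :
    (S.polIV j p μ ν (fun κ => ε κ * z κ - (if κ = μ then (1 - ε μ) / 2 else 0) +
        (if κ = ν then (1 - ε ν) / 2 else 0)) : ℂ) -
      (S.β j p : ℂ) * wilsonQ ν μ (fun κ => ε κ * z κ - (if κ = μ then (1 - ε μ) / 2 else 0) +
        (if κ = ν then (1 - ε ν) / 2 else 0)) =
    ((ε μ * ε ν : ℤ) : ℂ) * ((S.polIV j p μ ν z : ℂ) - (S.β j p : ℂ) * wilsonQ ν μ z) := by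
  rw [polIV_reflect hD j p hε μ ν z, wilsonQ_transpose_reflect μ ν hε z]
  ring

/-- … together with the permutation clause … [cite: Balaban1987RG1, (5.6) p.293 with (5.37)–(5.38) p.297] -/
theorem transposedRemainder537_perm (hD : Definitions S) (j : ℕ) (p : Fin (j + 1) → ℝ) (σ : Equiv.Perm (Fin 4))
    (μ ν : Fin 4) (x : Pt 4) :
    (S.polIV j p (σ μ) (σ ν) (x ∘ σ.symm) : ℂ) - (S.β j p : ℂ) * wilsonQ (σ ν) (σ μ) (x ∘ σ.symm) =
      (S.polIV j p μ ν x : ℂ) - (S.β j p : ℂ) * wilsonQ ν μ x := by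
  rw [(hD.d121 j p).1 σ μ ν x, wilsonQ_perm]

/-- … and the transposition clause. [cite: Balaban1987RG1, (5.8) p.293 with (5.37)–(5.38) p.297] -/
theorem transposedRemainder537_transpose (hD : Definitions S) (j : ℕ) (p : Fin (j + 1) → ℝ) (μ ν : Fin 4) (z : Pt 4) :
    (S.polIV j p μ ν z : ℂ) - (S.β j p : ℂ) * wilsonQ ν μ z =
      (S.polIV j p ν μ (-z) : ℂ) - (S.β j p : ℂ) * wilsonQ μ ν (-z) := by
  rw [(hD.d121 j p).2.2 μ ν z, wilsonQ_neg_transpose]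

end

end Summit.QuantumFields.BalabanUV.Beta.EriceFlowEnclosureB12AsPrintedOrientation
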